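import Summits.Ventures.PercRepro.RankLevelSetPerElemLow

/-! # RankLevelSetPerElemThreeSkel — THE SKELETON OF (★★) AT LEVEL `3`, PART 1: THE CIRCUIT OF `y` IN AN
ABSORBING SET, THE FREE SETS, AND THE MEMBERS WHOSE CIRCUIT WITH `y` HAS FOUR ELEMENTS (night-1 g35; dossier
§47.9; on `RankLevelSetPerElemLow`; the triangle members and the skeleton theorem are in
`RankLevelSetPerElemThreeCount`)

For `y ∈ E` with `y ∉ cl {z}` for all `z ≠ y`, an absorbing `k`-set `Z ∈ lowAbsorbAt M y k` spans `y`
(`mem_closure_of_mem_lowAbsorbAt'`) and carries the fundamental circuit `C = M.fundCircuit y Z ⊆ insert y Z`, with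
`3 ≤ #C ≤ k + 1` (`fundCircuit_ncard_absorb`: a circuit of two elements would make `y` parallel to the other, of
one a loop); any circuit through `y` inside `insert y (E ∖ Q)` for a bi-independent `Q` is the fundamental
circuit of `y` in `E ∖ Q` (`eq_fundCircuit_compl`). The FREE bi-independent `3`-sets avoiding `y` inject into the
bi-independent `4`-sets through `y` whose complement does not span `y` by `Z ↦ insert y Z` (`free_three_le`), and
the absorbing `3`-sets whose circuit with `y` has four elements inject into the bi-independent `4`-sets through
`y` whose complement spans `y` with a four-element circuit by `Z ↦ insert y T` for a through-quadruple `T`,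
assumed to exist (`absorb_four_le`; the image is recovered as the circuit of `y` in `E ∖ Q`). Every declaration
has a docstring; imports: the cell's own modules and Mathlib only. Axioms: standard. -/

namespace PercRepro

open Set Matroid

variable {α : Type} (M : Matroid α) [M.Finite]

/-! ## The fundamental circuit of `y` in an absorbing set -/

omit [M.Finite] in
/-- An absorbing set spans `y`: `y ∈ cl Z` for `Z ∈ lowAbsorbAt M y k`. -/
lemma mem_closure_of_mem_lowAbsorbAt' {y : α} (hy : y ∈ M.E) {k : ℕ} {Z : Set α} (hZ : Z ∈ lowAbsorbAt M y k) :
    y ∈ M.closure Z := by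
  obtain ⟨⟨hZE, -, hZi, -⟩, hyZ, hdep⟩ := hZ
  rw [hZi.mem_closure_iff_of_notMem hyZ, Matroid.dep_iff]
  exact ⟨hdep, Set.insert_subset hy hZE⟩

/-- For `y` without a parallel partner and any element `z₀ ≠ y`, the fundamental circuit of `y` in an
absorbing `k`-set `Z` has at least three and at most `k + 1` elements. -/
lemma fundCircuit_ncard_absorb {y : α} (hy : y ∈ M.E) (hnp : ∀ z, z ≠ y → y ∉ M.closure {z})
    {z₀ : α} (hz₀y : z₀ ≠ y) {k : ℕ} {Z : Set α} (hZ : Z ∈ lowAbsorbAt M y k) :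
    3 ≤ (M.fundCircuit y Z).ncard ∧ (M.fundCircuit y Z).ncard ≤ k + 1 := by
  have hycl := mem_closure_of_mem_lowAbsorbAt' M hy hZ
  obtain ⟨⟨hZE, hZk, hZi, -⟩, hyZ, -⟩ := hZ
  have hC : M.IsCircuit (M.fundCircuit y Z) := hZi.fundCircuit_isCircuit hycl hyZ
  have hsub : M.fundCircuit y Z ⊆ insert y Z := M.fundCircuit_subset_insert y Z
  have hZfin : Z.Finite := M.ground_finite.subset hZE
  have hyC : y ∈ M.fundCircuit y Z := M.mem_fundCircuit y Z
  constructor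
  · by_contra hlt
    have hlt' : (M.fundCircuit y Z).ncard ≤ 2 := by omega
    have hfin : (M.fundCircuit y Z).Finite := hZfin.insert y |>.subset hsub
    have h1 : (M.fundCircuit y Z \ {y}).ncard ≤ 1 := by
      rw [Set.ncard_sdiff_singleton_of_mem hyC]; omega
    have hycl' : y ∈ M.closure (M.fundCircuit y Z \ {y}) := hC.mem_closure_sdiff_singleton_of_mem hyC
    rcases (Set.ncard_le_one_iff_eq (hfin.subset Set.sdiff_subset)).mp h1 with h0 | ⟨a, ha⟩
    · rw [h0] at hycl'
      have : y ∈ M.closure {z₀} := M.closure_subset_closure (Set.empty_subset _) hycl'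
      exact hnp z₀ hz₀y this
    · rw [ha] at hycl'
      have hay : a ≠ y := by
        intro h; subst h
        have : a ∈ M.fundCircuit a Z \ {a} := by rw [ha]; exact Set.mem_singleton a
        exact this.2 (Set.mem_singleton a)
      exact hnp a hay hycl'
  · calc (M.fundCircuit y Z).ncard ≤ (insert y Z).ncard := Set.ncard_le_ncard hsub (hZfin.insert y)
      _ = k + 1 := by rw [Set.ncard_insert_of_notMem hyZ hZfin, hZk]

omit [M.Finite] in
/-- For a bi-independent `Q` through `y` with `y ∈ cl (E ∖ Q)`: any circuit `C` with `y ∈ C ⊆ insert y (E ∖ Q)`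
is the fundamental circuit of `y` in `E ∖ Q`. -/
lemma eq_fundCircuit_compl {y : α} {Q : Set α} (hQ : Q ∈ biIndep M 4) {C : Set α} (hC : M.IsCircuit C)
    (hCs : C ⊆ insert y (M.E \ Q)) : C = M.fundCircuit y (M.E \ Q) :=
  hC.eq_fundCircuit_of_subset hQ.2.2.2 hCs

/-! ## The free sets -/

/-- **The free bi-independent `3`-sets avoiding `y` inject into the bi-independent `4`-sets through `y` whose
complement does not span `y`** (`Z ↦ insert y Z`). -/
lemma free_three_le {y : α} (hy : y ∈ M.E) :
    {Z ∈ biIndep M 3 | y ∉ Z ∧ M.Indep (insert y Z)}.ncard ≤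
      {Q ∈ biIndep M 4 | y ∈ Q ∧ M.Indep (insert y (M.E \ Q))}.ncard := by
  refine Set.ncard_le_ncard_of_injOn (fun Z => insert y Z) ?_ ?_
    ((biIndep_finite M 4).subset (fun Q hQ => hQ.1))
  · rintro Z ⟨⟨hZE, hZ3, -, hcind⟩, hyZ, hind⟩
    have hZfin : Z.Finite := M.ground_finite.subset hZE
    have hcompl : M.E \ insert y Z = (M.E \ Z) \ {y} := by
      ext x; simp only [Set.mem_sdiff, Set.mem_insert_iff, Set.mem_singleton_iff, not_or]; tauto
    refine ⟨⟨Set.insert_subset hy hZE, ?_, hind, ?_⟩, Set.mem_insert y Z, ?_⟩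
    · rw [Set.ncard_insert_of_notMem hyZ hZfin, hZ3]
    · rw [hcompl]; exact hcind.subset Set.sdiff_subset
    · rw [hcompl, Set.insert_sdiff_singleton]
      have hyE : y ∈ M.E \ Z := ⟨hy, hyZ⟩
      rw [Set.insert_eq_of_mem hyE]; exact hcind
  · rintro Z₁ ⟨-, hy₁, -⟩ Z₂ ⟨-, hy₂, -⟩ heq
    have heq' : insert y Z₁ = insert y Z₂ := heq
    have : (insert y Z₁) \ {y} = (insert y Z₂) \ {y} := by rw [heq']
    rwa [Set.insert_sdiff_of_mem _ (Set.mem_singleton y), Set.insert_sdiff_of_mem _ (Set.mem_singleton y),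
      Set.sdiff_singleton_eq_self hy₁, Set.sdiff_singleton_eq_self hy₂] at this

/-! ## The members whose circuit with `y` has four elements -/

/-- **The absorbing `3`-sets whose circuit with `y` has four elements inject into the bi-independent `4`-sets
through `y` whose complement spans `y` with a four-element circuit**, given a through-quadruple for each
(`hA`): `Z ↦ insert y T`, recovered as the circuit of `y` in `E ∖ Q`. -/
lemma absorb_four_le {y : α} (hy : y ∈ M.E)
    (hA : ∀ Z ∈ lowAbsorbAt M y 3, (M.fundCircuit y Z).ncard = 4 →
      ∃ T, T ⊆ M.E \ insert y Z ∧ T.ncard = 3 ∧ insert y T ∈ biIndep M 4) :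
    {Z ∈ lowAbsorbAt M y 3 | (M.fundCircuit y Z).ncard = 4}.ncard ≤
      {Q ∈ biIndep M 4 | y ∈ Q ∧ ¬ M.Indep (insert y (M.E \ Q)) ∧
        (M.fundCircuit y (M.E \ Q)).ncard = 4}.ncard := by
  have hex : ∀ Z : Set α, ∃ Q : Set α, Z ∈ lowAbsorbAt M y 3 → (M.fundCircuit y Z).ncard = 4 →
      (Q ∈ biIndep M 4 ∧ y ∈ Q ∧ ¬ M.Indep (insert y (M.E \ Q)) ∧ (M.fundCircuit y (M.E \ Q)).ncard = 4) ∧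
        M.fundCircuit y (M.E \ Q) = insert y Z := by
    intro Z
    by_cases h : Z ∈ lowAbsorbAt M y 3 ∧ (M.fundCircuit y Z).ncard = 4
    · obtain ⟨T, hTJ, hT3, hTb⟩ := hA Z h.1 h.2
      obtain ⟨⟨hZE, hZ3, hZi, hcind⟩, hyZ, hdep⟩ := h.1
      have hZfin : Z.Finite := M.ground_finite.subset hZE
      have hycl : y ∈ M.closure Z := mem_closure_of_mem_lowAbsorbAt' M hy ⟨⟨hZE, hZ3, hZi, hcind⟩, hyZ, hdep⟩
      have hC : M.IsCircuit (M.fundCircuit y Z) := hZi.fundCircuit_isCircuit hycl hyZ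
      -- the circuit is all of `insert y Z`
      have hCeq : M.fundCircuit y Z = insert y Z := by
        refine Set.eq_of_subset_of_ncard_le (M.fundCircuit_subset_insert y Z) ?_ (hZfin.insert y)
        rw [Set.ncard_insert_of_notMem hyZ hZfin, hZ3, h.2]
      have hZsub : Z ⊆ M.E \ insert y T := by
        intro x hx
        refine ⟨hZE hx, ?_⟩
        simp only [Set.mem_insert_iff, not_or]
        exact ⟨fun hxy => hyZ (hxy ▸ hx), fun hxT => (hTJ hxT).2 (Set.mem_insert_of_mem y hx)⟩
      have hCsub : M.fundCircuit y Z ⊆ insert y (M.E \ insert y T) := by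
        rw [hCeq]; exact Set.insert_subset_insert hZsub
      have hfund : M.fundCircuit y (M.E \ insert y T) = insert y Z := by
        rw [← eq_fundCircuit_compl M hTb hC hCsub, hCeq]
      refine ⟨insert y T, fun _ _ => ⟨⟨hTb, Set.mem_insert y T, ?_, ?_⟩, hfund⟩⟩
      · intro hind
        exact hdep (hind.subset (Set.insert_subset_insert hZsub))
      · rw [hfund, Set.ncard_insert_of_notMem hyZ hZfin, hZ3]
    · exact ⟨∅, fun h1 h2 => absurd ⟨h1, h2⟩ h⟩
  choose f hf using hex
  refine Set.ncard_le_ncard_of_injOn f (fun Z hZ => (hf Z hZ.1 hZ.2).1) ?_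
    ((biIndep_finite M 4).subset (fun Q hQ => hQ.1))
  rintro Z₁ hZ₁ Z₂ hZ₂ heq
  have h₁ := (hf Z₁ hZ₁.1 hZ₁.2).2
  have h₂ := (hf Z₂ hZ₂.1 hZ₂.2).2
  rw [heq] at h₁
  have heq' : insert y Z₁ = insert y Z₂ := by rw [← h₁, ← h₂]
  have : (insert y Z₁) \ {y} = (insert y Z₂) \ {y} := by rw [heq']
  rwa [Set.insert_sdiff_of_mem _ (Set.mem_singleton y), Set.insert_sdiff_of_mem _ (Set.mem_singleton y),
    Set.sdiff_singleton_eq_self hZ₁.1.2.1, Set.sdiff_singleton_eq_self hZ₂.1.2.1] at this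

end PercRepro
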